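import Literature.Analysis.Fourier.SmoothWindow
import Literature.Analysis.Fourier.SmoothWindowKernel
import Literature.Analysis.Fourier.SmoothWindowOscillatory
import Mathlib.Analysis.Calculus.IteratedDeriv.Lemmas
import HarnessLib

/-!
# Smooth cutoffs adapted to a set at scale `ε`, split into unit blocks

Topic `Literature/Analysis/Fourier`. Definitions with bodies and theorems; everything is PROVED
(no named facts). This is Step 1–2 of the proof of [DyatlovJinNonnenmacher2021, Prop. 2.9]
("replace the indicator functions by smoothed out versions `χ_±` with `supp χ_± ⊂ Ω_±(h)`,
`supp(1-χ_±) ∩ Ω_± = ∅`, `sup|∂^N χ_±| ≤ C_N h^{-N}` … write `χ_± = ∑_j χ_j^±`, each supported in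
an interval of size 2"), realised with a smooth partition of unity instead of a convolution:

* `pouBump y = σ(y+1) - σ(y)` (`σ` = Mathlib's `Real.smoothTransition`, through the tree's
  `smoothWindow (-1) 0`): `C^∞`, values in `[0,1]`, support in `[-1,1]`, `|∂^k| ≤ W_k`
  (`windowDerivConst`), and the telescoping identity `∑_{n<L} pouBump (s-n) = σ(s+1) - σ(s+1-L)`,
  whence `∑_n pouBump(s - n) = 1` — a smooth partition of unity on `ℝ`;
* `gridBump ε M n x = pouBump (ε⁻¹ x + M - n)` — the bumps of the `ε`-grid centred at
  `gridCenter ε M n = (n - M) ε`, `n < 2M+1`, with `|∂^k| ≤ W_k ε^{-k}`;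
* `activeSet Ω ε M` — the indices whose cell `[c_n - ε, c_n + ε]` meets `Ω`;
  `blockSet Ω ε M j` — those with `⌊c_n⌋ = j`; `blockFun Ω ε M j = ∑_{n ∈ blockSet} gridBump` —
  **the unit blocks `χ_j`** of the cutoff `χ = ∑_{n active} gridBump = ∑_j χ_j`.

Main results: `χ = 1` on `Ω ∩ (-Mε, Mε)` (`sum_gridBump_activeSet_eq_one`); `supp χ_j ⊆
Ω(2ε) ∩ [j-ε, j+1+ε]` also for all derivatives (`mem_of_iteratedDeriv_blockFun_ne_zero`);
`|χ_j| ≤ 1` (`norm_blockFun_le_one`); `χ_j χ_{j'} = 0` for `|j-j'| ≥ 2`, `ε < 1/2`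
(`blockFun_mul_blockFun_eq_zero`); `|∂^k χ_j| ≤ 3 W_k ε^{-k}` (`norm_iteratedDeriv_blockFun_le`);
Leibniz bound for products `χ_j \bar χ_{j'}`-type functions and the Fourier decay
`(2π|w|)^N |𝓕(χ_j χ_{j'})(w)| ≤ 2 · 9 E_N ε^{-N}` (`pow_mul_norm_fourier_blockFun_mul_le`) used in
Step 5 (non-stationary phase) of the printed proof.

## References

* [DyatlovJinNonnenmacher2021] S. Dyatlov, L. Jin, S. Nonnenmacher, J. Amer. Math. Soc. 35 (2022)
  = arXiv:1906.08923, §2.4, proof of Prop. 2.9, Steps 1, 2 and 5.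
* Partition of unity by translates of `σ(y+1) - σ(y)`: folklore.
-/

noncomputable section

open Set MeasureTheory Finset
open scoped ContDiff FourierTransform Real

namespace Literature.Analysis.Fourier

open _root_.Real (smoothTransition)

/-! ## The basic bump of the partition of unity -/

/-- `w(y) = σ(y + 1) - σ(y)`, the window `smoothWindow (-1) 0` (complex-valued; the same real
function appears as `Literature.NumberTheory.Automorphic.unitBump` in `HyperbolicDirichletForm.lean`,
not imported here to keep the import graph light). [folklore] -/
def pouBump : ℝ → ℂ := smoothWindow (-1) 0

/-- `w(y) = σ(y+1) - σ(y)`. [folklore] -/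
theorem pouBump_apply (y : ℝ) : pouBump y = smoothStep (y + 1) - smoothStep y := by
  simp [pouBump, smoothWindow_apply, sub_neg_eq_add]

/-- The real number `σ(y+1) - σ(y) ∈ [0, 1]` of which `pouBump y` is the cast. [folklore] -/
def pouBumpRe (y : ℝ) : ℝ := smoothTransition (y + 1) - smoothTransition y

/-- `w` is the complex cast of the real bump `pouBumpRe`. [folklore] -/
theorem pouBump_eq_ofReal (y : ℝ) : pouBump y = ((pouBumpRe y : ℝ) : ℂ) := by
  rw [pouBump_apply, pouBumpRe, smoothStep_apply, smoothStep_apply, Complex.ofReal_sub]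

/-- `0 ≤ σ(y+1) - σ(y)` (`σ` is monotone). [folklore] -/
theorem pouBumpRe_nonneg (y : ℝ) : 0 ≤ pouBumpRe y :=
  sub_nonneg.2 (_root_.Real.smoothTransition.monotone (by linarith))

/-- `σ(y+1) - σ(y) ≤ 1`. [folklore] -/
theorem pouBumpRe_le_one (y : ℝ) : pouBumpRe y ≤ 1 := by
  have h1 := _root_.Real.smoothTransition.le_one (y + 1)
  have h2 := _root_.Real.smoothTransition.nonneg y
  unfold pouBumpRe; linarith

/-- `w` is `C^∞`. [folklore] -/
theorem contDiff_pouBump {n : ℕ∞} : ContDiff ℝ n pouBump := contDiff_smoothWindow _ _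

/-- `w` is continuous. [folklore] -/
@[fun_prop]
theorem continuous_pouBump : Continuous pouBump := continuous_smoothWindow _ _

/-- `|w| ≤ 1`. [folklore] -/
theorem norm_pouBump_le_one (y : ℝ) : ‖pouBump y‖ ≤ 1 := norm_smoothWindow_le_one (by norm_num) y

/-- `w(y) = 0` unless `-1 ≤ y ≤ 1`. [folklore] -/
theorem pouBump_eq_zero_of_not_mem {y : ℝ} (hy : y ∉ Icc (-1 : ℝ) 1) : pouBump y = 0 := by
  by_contra h
  have := support_smoothWindow_subset (a := (-1 : ℝ)) (b := 0) (by norm_num) (Function.mem_support.2 h)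
  exact hy (by simpa using this)

/-- `|w^{(k)}| ≤ W_k` (`W_0 = 1`, `W_k = 2 D_k`). [folklore] -/
theorem norm_iteratedDeriv_pouBump_le (k : ℕ) (y : ℝ) :
    ‖iteratedDeriv k pouBump y‖ ≤ windowDerivConst k := by
  rcases Nat.eq_zero_or_pos k with rfl | hk
  · rw [iteratedDeriv_zero, windowDerivConst_zero]; exact norm_pouBump_le_one y
  · rw [windowDerivConst, if_neg hk.ne']
    refine (norm_iteratedDeriv_smoothWindow_le hk.ne' y).trans ?_
    have h1 : (Icc (-1 : ℝ) (-1 + 1)).indicator (fun _ => (1 : ℝ)) y ≤ 1 :=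
      Set.indicator_le_self' (fun _ _ => zero_le_one) y
    have h2 : (Icc (0 : ℝ) (0 + 1)).indicator (fun _ => (1 : ℝ)) y ≤ 1 :=
      Set.indicator_le_self' (fun _ _ => zero_le_one) y
    nlinarith [stepDerivBound_nonneg k]

/-- All derivatives of `w` vanish off `[-1, 1]`. [folklore] -/
theorem iteratedDeriv_pouBump_eq_zero {k : ℕ} {y : ℝ} (hy : y ∉ Icc (-1 : ℝ) 1) :
    iteratedDeriv k pouBump y = 0 := by
  have hopen : IsOpen (Icc (-1 : ℝ) 1)ᶜ := isClosed_Icc.isOpen_compl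
  have h : EqOn pouBump (fun _ => (0 : ℂ)) (Icc (-1 : ℝ) 1)ᶜ := fun z hz => pouBump_eq_zero_of_not_mem hz
  rw [h.iteratedDeriv_of_isOpen hopen k hy, iteratedDeriv_const]
  split_ifs <;> rfl

/-- **Telescoping:** `∑_{n<L} w(s - n) = σ(s+1) - σ(s+1-L)`. [folklore] -/
theorem sum_range_pouBump (s : ℝ) (L : ℕ) :
    ∑ n ∈ Finset.range L, pouBump (s - n) = smoothStep (s + 1) - smoothStep (s + 1 - L) := by
  induction L with
  | zero => simp
  | succ L ih =>
    rw [Finset.sum_range_succ, ih, pouBump_apply]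
    push_cast
    ring_nf

/-- **Partition of unity:** `∑_{n<L} w(s - n) = 1` for `0 ≤ s ≤ L - 1`. [folklore] -/
theorem sum_range_pouBump_eq_one {s : ℝ} {L : ℕ} (h0 : 0 ≤ s) (h1 : s + 1 ≤ L) :
    ∑ n ∈ Finset.range L, pouBump (s - n) = 1 := by
  rw [sum_range_pouBump, smoothStep_of_one_le (by linarith), smoothStep_of_nonpos (by linarith),
    sub_zero]

/-- A sub-sum of the partition of unity has norm at most `1`. [folklore] -/
theorem norm_sum_pouBump_le_one (s : ℝ) {L : ℕ} {T : Finset ℕ} (hT : T ⊆ Finset.range L) :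
    ‖∑ n ∈ T, pouBump (s - n)‖ ≤ 1 := by
  have hre : ∀ n, pouBump (s - n) = ((pouBumpRe (s - n) : ℝ) : ℂ) := fun n => pouBump_eq_ofReal _
  simp_rw [hre]
  rw [← Complex.ofReal_sum, Complex.norm_real, Real.norm_eq_abs,
    abs_of_nonneg (Finset.sum_nonneg fun n _ => pouBumpRe_nonneg _)]
  calc ∑ n ∈ T, pouBumpRe (s - n) ≤ ∑ n ∈ Finset.range L, pouBumpRe (s - n) :=
        Finset.sum_le_sum_of_subset_of_nonneg hT fun n _ _ => pouBumpRe_nonneg _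
    _ = (∑ n ∈ Finset.range L, pouBump (s - n)).re := by
        simp_rw [hre]; rw [← Complex.ofReal_sum, Complex.ofReal_re]
    _ ≤ 1 := by
        rw [sum_range_pouBump, Complex.sub_re, smoothStep_apply, smoothStep_apply,
          Complex.ofReal_re, Complex.ofReal_re]
        linarith [_root_.Real.smoothTransition.le_one (s + 1),
          _root_.Real.smoothTransition.nonneg (s + 1 - L)]

/-! ## The `ε`-grid -/

/-- Centre `c_n = (n - M) ε` of the `n`-th cell of the `ε`-grid on `[-Mε, Mε]`. [folklore] -/
def gridCenter (ε : ℝ) (M n : ℕ) : ℝ := ((n : ℝ) - M) * ε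

/-- The `n`-th bump of the `ε`-grid: `p_n(x) = w(ε⁻¹ x + M - n)`, supported in
`[c_n - ε, c_n + ε]`. [cite: DyatlovJinNonnenmacher2021, §2.4, proof of Prop. 2.9, Step 1] -/
def gridBump (ε : ℝ) (M n : ℕ) (x : ℝ) : ℂ := pouBump (ε⁻¹ * x + ((M : ℝ) - n))

/-- `p_n` as the composition of a translate of `w` with `x ↦ ε⁻¹ x`. [folklore] -/
theorem gridBump_eq (ε : ℝ) (M n : ℕ) :
    gridBump ε M n = fun x => (fun y => pouBump (y + ((M : ℝ) - n))) (ε⁻¹ * x) := rfl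

/-- `p_n` is `C^∞`. [folklore] -/
theorem contDiff_gridBump (ε : ℝ) (M n : ℕ) {k : ℕ∞} : ContDiff ℝ k (gridBump ε M n) := by
  unfold gridBump
  exact contDiff_pouBump.comp ((contDiff_const.mul contDiff_id).add contDiff_const)

/-- `p_n` is continuous. [folklore] -/
@[fun_prop]
theorem continuous_gridBump (ε : ℝ) (M n : ℕ) : Continuous (gridBump ε M n) := by
  unfold gridBump; fun_prop

/-- The argument of `w` in `p_n(x)`, rewritten: `ε⁻¹ x + M - n = ε⁻¹ (x - c_n)`. [folklore] -/
theorem gridBump_arg {ε : ℝ} (hε : 0 < ε) (M n : ℕ) (x : ℝ) :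
    ε⁻¹ * x + ((M : ℝ) - n) = ε⁻¹ * (x - gridCenter ε M n) := by
  unfold gridCenter; field_simp; ring

/-- `p_n(x) ≠ 0 ⟹ x ∈ [c_n - ε, c_n + ε]`. [folklore] -/
theorem mem_Icc_of_gridBump_arg_mem {ε : ℝ} (hε : 0 < ε) {M n : ℕ} {x : ℝ}
    (h : ε⁻¹ * x + ((M : ℝ) - n) ∈ Icc (-1 : ℝ) 1) :
    x ∈ Icc (gridCenter ε M n - ε) (gridCenter ε M n + ε) := by
  rw [gridBump_arg hε] at h
  obtain ⟨h1, h2⟩ := h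
  have e : x - gridCenter ε M n = ε * (ε⁻¹ * (x - gridCenter ε M n)) := by field_simp
  constructor <;> nlinarith

/-- All derivatives of `p_n` (including `p_n` itself) vanish off `[c_n - ε, c_n + ε]`, and
`|p_n^{(k)}| ≤ W_k ε^{-k}`. [cite: DyatlovJinNonnenmacher2021, §2.4, proof of Prop. 2.9, Step 1, (2.34)] -/
theorem iteratedDeriv_gridBump {ε : ℝ} (M n k : ℕ) (x : ℝ) :
    iteratedDeriv k (gridBump ε M n) x =
      (ε⁻¹) ^ k * iteratedDeriv k pouBump (ε⁻¹ * x + ((M : ℝ) - n)) := by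
  have hg : ContDiff ℝ k (fun y => pouBump (y + ((M : ℝ) - n))) :=
    contDiff_pouBump.comp (contDiff_id.add contDiff_const)
  rw [gridBump_eq, iteratedDeriv_comp_const_smul hg ε⁻¹]
  simp only [Complex.real_smul, Complex.ofReal_pow, Complex.ofReal_inv]
  rw [iteratedDeriv_comp_add_const k pouBump ((M : ℝ) - n)]

/-- `|p_n^{(k)}| ≤ W_k ε^{-k}`. [folklore] -/
theorem norm_iteratedDeriv_gridBump_le {ε : ℝ} (hε : 0 < ε) (M n k : ℕ) (x : ℝ) :
    ‖iteratedDeriv k (gridBump ε M n) x‖ ≤ (ε⁻¹) ^ k * windowDerivConst k := by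
  rw [iteratedDeriv_gridBump, norm_mul, Complex.norm_pow, Complex.norm_real, Real.norm_eq_abs,
    abs_of_pos (inv_pos.2 hε)]
  exact mul_le_mul_of_nonneg_left (norm_iteratedDeriv_pouBump_le _ _) (by positivity)

/-- `p_n^{(k)}` vanishes off `[c_n - ε, c_n + ε]`. [folklore] -/
theorem iteratedDeriv_gridBump_eq_zero {ε : ℝ} (hε : 0 < ε) {M n : ℕ} (k : ℕ) {x : ℝ}
    (hx : x ∉ Icc (gridCenter ε M n - ε) (gridCenter ε M n + ε)) :
    iteratedDeriv k (gridBump ε M n) x = 0 := by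
  rw [iteratedDeriv_gridBump, iteratedDeriv_pouBump_eq_zero, mul_zero]
  exact fun h => hx (mem_Icc_of_gridBump_arg_mem hε h)

/-- `p_n` vanishes off `[c_n - ε, c_n + ε]`. [folklore] -/
theorem gridBump_eq_zero {ε : ℝ} (hε : 0 < ε) {M n : ℕ} {x : ℝ}
    (hx : x ∉ Icc (gridCenter ε M n - ε) (gridCenter ε M n + ε)) : gridBump ε M n x = 0 := by
  simpa using iteratedDeriv_gridBump_eq_zero hε 0 hx

/-- `p_n` is the cast of a real number in `[0, 1]`. [folklore] -/
theorem gridBump_eq_ofReal (ε : ℝ) (M n : ℕ) (x : ℝ) :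
    gridBump ε M n x = ((pouBumpRe (ε⁻¹ * x + ((M : ℝ) - n)) : ℝ) : ℂ) := pouBump_eq_ofReal _

/-- **The grid bumps sum to `1` on `[-Mε, Mε]`.** [cite: DyatlovJinNonnenmacher2021, §2.4, proof of Prop. 2.9, Step 2 ("1 = ∑_j χ_j")] -/
theorem sum_range_gridBump_eq_one {ε : ℝ} (hε : 0 < ε) {M : ℕ} {x : ℝ} (hx : |x| ≤ M * ε) :
    ∑ n ∈ Finset.range (2 * M + 1), gridBump ε M n x = 1 := by
  have hs : ∀ n : ℕ, gridBump ε M n x = pouBump ((ε⁻¹ * x + M) - n) := by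
    intro n; simp only [gridBump]; ring_nf
  simp_rw [hs]
  rw [abs_le] at hx
  have h1 : -(M : ℝ) ≤ ε⁻¹ * x := by
    rw [← div_le_iff₀' (inv_pos.2 hε), div_inv_eq_mul]; nlinarith
  have h2 : ε⁻¹ * x ≤ M := by
    rw [← le_div_iff₀' (inv_pos.2 hε), div_inv_eq_mul]; nlinarith
  refine sum_range_pouBump_eq_one (by linarith) ?_
  push_cast; linarith

/-! ## The cutoff adapted to a set and its unit blocks -/

/-- The grid indices `n < 2M+1` whose cell `[c_n - ε, c_n + ε]` meets `Ω`. [cite: DyatlovJinNonnenmacher2021, §2.4, proof of Prop. 2.9, Step 1 (the smoothed indicator of `Ω(h/2)`)] -/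
def activeSet (Ω : Set ℝ) (ε : ℝ) (M : ℕ) : Finset ℕ := by
  classical
  exact (Finset.range (2 * M + 1)).filter
    fun n => (Ω ∩ Icc (gridCenter ε M n - ε) (gridCenter ε M n + ε)).Nonempty

/-- Membership in `activeSet`. [folklore] -/
theorem mem_activeSet {Ω : Set ℝ} {ε : ℝ} {M n : ℕ} :
    n ∈ activeSet Ω ε M ↔ n < 2 * M + 1 ∧
      (Ω ∩ Icc (gridCenter ε M n - ε) (gridCenter ε M n + ε)).Nonempty := by
  classical
  simp [activeSet, Finset.mem_filter]

/-- `activeSet ⊆ range (2M+1)`. [folklore] -/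
theorem activeSet_subset_range (Ω : Set ℝ) (ε : ℝ) (M : ℕ) :
    activeSet Ω ε M ⊆ Finset.range (2 * M + 1) := by
  classical
  exact Finset.filter_subset _ _

/-- The indices of the active cells with `⌊c_n⌋ = j`. [cite: DyatlovJinNonnenmacher2021, §2.4, proof of Prop. 2.9, Step 2] -/
def blockSet (Ω : Set ℝ) (ε : ℝ) (M : ℕ) (j : ℤ) : Finset ℕ := by
  classical
  exact (activeSet Ω ε M).filter fun n => ⌊gridCenter ε M n⌋ = j

/-- Membership in `blockSet`. [folklore] -/
theorem mem_blockSet {Ω : Set ℝ} {ε : ℝ} {M : ℕ} {j : ℤ} {n : ℕ} :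
    n ∈ blockSet Ω ε M j ↔ n ∈ activeSet Ω ε M ∧ ⌊gridCenter ε M n⌋ = j := by
  classical
  simp [blockSet, Finset.mem_filter]

/-- `blockSet j ⊆ range (2M+1)`. [folklore] -/
theorem blockSet_subset_range (Ω : Set ℝ) (ε : ℝ) (M : ℕ) (j : ℤ) :
    blockSet Ω ε M j ⊆ Finset.range (2 * M + 1) := fun _ hn =>
  activeSet_subset_range Ω ε M (mem_blockSet.1 hn).1

/-- **The unit block** `χ_j = ∑_{n ∈ blockSet j} p_n` of the smooth cutoff adapted to `Ω`
(the printed `χ_j^± = χ_j χ_±`, supported in `Ω_±(h) ∩ (j-1, j+1)`; here supported in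
`Ω(2ε) ∩ [j-ε, j+1+ε]`). [cite: DyatlovJinNonnenmacher2021, §2.4, proof of Prop. 2.9, Step 2, (2.35)] -/
def blockFun (Ω : Set ℝ) (ε : ℝ) (M : ℕ) (j : ℤ) (x : ℝ) : ℂ :=
  ∑ n ∈ blockSet Ω ε M j, gridBump ε M n x

/-- `χ_j` as a sum of functions. [folklore] -/
theorem blockFun_eq (Ω : Set ℝ) (ε : ℝ) (M : ℕ) (j : ℤ) :
    blockFun Ω ε M j = ∑ n ∈ blockSet Ω ε M j, gridBump ε M n := by
  ext x; simp [blockFun, Finset.sum_apply]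

/-- `χ_j` is `C^∞`. [folklore] -/
theorem contDiff_blockFun (Ω : Set ℝ) (ε : ℝ) (M : ℕ) (j : ℤ) {k : ℕ∞} :
    ContDiff ℝ k (blockFun Ω ε M j) := by
  show ContDiff ℝ k fun x => ∑ n ∈ blockSet Ω ε M j, gridBump ε M n x
  exact ContDiff.sum fun n _ => contDiff_gridBump ε M n

/-- `χ_j` is continuous. [folklore] -/
@[fun_prop]
theorem continuous_blockFun (Ω : Set ℝ) (ε : ℝ) (M : ℕ) (j : ℤ) : Continuous (blockFun Ω ε M j) := by
  show Continuous fun x => ∑ n ∈ blockSet Ω ε M j, gridBump ε M n x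
  exact continuous_finsetSum _ fun n _ => continuous_gridBump ε M n

/-- `χ_j` is real-valued: `conj χ_j = χ_j`. [folklore] -/
theorem conj_blockFun (Ω : Set ℝ) (ε : ℝ) (M : ℕ) (j : ℤ) (x : ℝ) :
    (starRingEnd ℂ) (blockFun Ω ε M j x) = blockFun Ω ε M j x := by
  simp only [blockFun, map_sum, gridBump_eq_ofReal, Complex.conj_ofReal]

/-- `χ_j^{(k)} = ∑_{n ∈ blockSet j} p_n^{(k)}`. [folklore] -/
theorem iteratedDeriv_blockFun (Ω : Set ℝ) (ε : ℝ) (M : ℕ) (j : ℤ) (k : ℕ) (x : ℝ) :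
    iteratedDeriv k (blockFun Ω ε M j) x = ∑ n ∈ blockSet Ω ε M j, iteratedDeriv k (gridBump ε M n) x := by
  rw [blockFun_eq, iteratedDeriv_sum fun n _ => (contDiff_gridBump ε M n).contDiffAt]

/-- **Support of the blocks and of all their derivatives:** if `χ_j^{(k)}(x) ≠ 0` then
`x ∈ [j - ε, j + 1 + ε]` and `x ∈ Ω(2ε) = {x : ∃ y ∈ Ω, |x - y| ≤ 2ε}`. [cite: DyatlovJinNonnenmacher2021, §2.4, proof of Prop. 2.9, Steps 1–2, (2.33) and (2.35)] -/
theorem mem_of_iteratedDeriv_blockFun_ne_zero {Ω : Set ℝ} {ε : ℝ} (hε : 0 < ε) {M : ℕ} {j : ℤ}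
    {k : ℕ} {x : ℝ} (hx : iteratedDeriv k (blockFun Ω ε M j) x ≠ 0) :
    x ∈ Icc ((j : ℝ) - ε) (j + 1 + ε) ∧ ∃ y ∈ Ω, |x - y| ≤ 2 * ε := by
  rw [iteratedDeriv_blockFun] at hx
  obtain ⟨n, hn, hne⟩ := Finset.exists_ne_zero_of_sum_ne_zero hx
  obtain ⟨hact, hfl⟩ := mem_blockSet.1 hn
  have hxI : x ∈ Icc (gridCenter ε M n - ε) (gridCenter ε M n + ε) := by
    by_contra h; exact hne (iteratedDeriv_gridBump_eq_zero hε k h)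
  obtain ⟨-, ⟨y, hyΩ, hyI⟩⟩ := mem_activeSet.1 hact
  have hc1 : (j : ℝ) ≤ gridCenter ε M n := by rw [← hfl]; exact Int.floor_le _
  have hc2 : gridCenter ε M n < j + 1 := by rw [← hfl]; exact Int.lt_floor_add_one _
  refine ⟨⟨by linarith [hxI.1], by linarith [hxI.2]⟩, y, hyΩ, ?_⟩
  rw [abs_le]; constructor <;> linarith [hxI.1, hxI.2, hyI.1, hyI.2]

/-- If `χ_j(x) ≠ 0` then `x ∈ [j-ε, j+1+ε] ∩ Ω(2ε)`. [folklore] -/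
theorem mem_of_blockFun_ne_zero {Ω : Set ℝ} {ε : ℝ} (hε : 0 < ε) {M : ℕ} {j : ℤ} {x : ℝ}
    (hx : blockFun Ω ε M j x ≠ 0) :
    x ∈ Icc ((j : ℝ) - ε) (j + 1 + ε) ∧ ∃ y ∈ Ω, |x - y| ≤ 2 * ε :=
  mem_of_iteratedDeriv_blockFun_ne_zero hε (k := 0) (by simpa using hx)

/-- `|χ_j| ≤ 1` (a sub-sum of a partition of unity by nonnegative functions). [cite: DyatlovJinNonnenmacher2021, §2.4, proof of Prop. 2.9, Step 1 ("χ_± ∈ C^∞(ℝ; [0,1])")] -/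
theorem norm_blockFun_le_one (Ω : Set ℝ) (ε : ℝ) (M : ℕ) (j : ℤ) (x : ℝ) :
    ‖blockFun Ω ε M j x‖ ≤ 1 := by
  have hs : ∀ n : ℕ, gridBump ε M n x = pouBump ((ε⁻¹ * x + M) - n) := by
    intro n; simp only [gridBump]; ring_nf
  simp only [blockFun, hs]
  exact norm_sum_pouBump_le_one _ (blockSet_subset_range Ω ε M j)

/-- **Blocks two apart have disjoint supports:** `χ_j χ_{j'} = 0` if `|j - j'| ≥ 2` and
`ε < 1/2`. [cite: DyatlovJinNonnenmacher2021, §2.4, proof of Prop. 2.9, Step 5 ("if |k-k'|>1 then supp χ_k^+ ∩ supp χ_{k'}^+ = ∅")] -/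
theorem blockFun_mul_blockFun_eq_zero {Ω Ω' : Set ℝ} {ε : ℝ} (hε : 0 < ε) (hε2 : ε < 1 / 2)
    {M : ℕ} {j j' : ℤ} (hjj : 2 ≤ |j - j'|) (x : ℝ) :
    blockFun Ω ε M j x * blockFun Ω' ε M j' x = 0 := by
  by_contra h
  obtain ⟨h1, h2⟩ := mul_ne_zero_iff.1 h
  obtain ⟨⟨a1, a2⟩, -⟩ := mem_of_blockFun_ne_zero hε h1
  obtain ⟨⟨b1, b2⟩, -⟩ := mem_of_blockFun_ne_zero hε h2
  have hint : (2 : ℝ) ≤ |((j : ℤ) : ℝ) - ((j' : ℤ) : ℝ)| := by exact_mod_cast hjj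
  rw [le_abs] at hint
  rcases hint with h | h <;> linarith

/-- At most three grid indices `n` have `|s - n| ≤ 1`. [folklore] -/
theorem card_filter_abs_sub_le_one (s : ℝ) (T : Finset ℕ) :
    (T.filter fun n : ℕ => |s - n| ≤ 1).card ≤ 3 := by
  have hsub : (T.filter fun n : ℕ => |s - n| ≤ 1) ⊆ Finset.Icc ⌈s - 1⌉₊ ⌊s + 1⌋₊ := by
    intro n hn
    rw [Finset.mem_filter] at hn
    obtain ⟨h1, h2⟩ := abs_le.1 hn.2
    rw [Finset.mem_Icc]
    exact ⟨Nat.ceil_le.2 (by linarith), Nat.le_floor (by linarith)⟩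
  refine (Finset.card_le_card hsub).trans ?_
  rw [Nat.card_Icc]
  have h : ⌊s + 1⌋₊ ≤ ⌈s - 1⌉₊ + 2 := by
    rcases lt_or_ge (s + 1) 0 with hs | hs
    · rw [Nat.floor_of_nonpos hs.le]; exact Nat.zero_le _
    · have h1 : ((⌊s + 1⌋₊ : ℕ) : ℝ) ≤ s + 1 := Nat.floor_le hs
      have h2 : s - 1 ≤ ((⌈s - 1⌉₊ : ℕ) : ℝ) := Nat.le_ceil _
      have : ((⌊s + 1⌋₊ : ℕ) : ℝ) ≤ ((⌈s - 1⌉₊ + 2 : ℕ) : ℝ) := by push_cast; linarith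
      exact_mod_cast this
  omega

/-- **Derivative bounds for the blocks:** `|χ_j^{(k)}(x)| ≤ 3 W_k ε^{-k}` (at each point at most
three grid bumps contribute). [cite: DyatlovJinNonnenmacher2021, §2.4, proof of Prop. 2.9, Steps 1–2, (2.34) ("sup|∂^N χ| ≤ C_N h^{-N}")] -/
theorem norm_iteratedDeriv_blockFun_le {Ω : Set ℝ} {ε : ℝ} (hε : 0 < ε) (M : ℕ) (j : ℤ) (k : ℕ)
    (x : ℝ) : ‖iteratedDeriv k (blockFun Ω ε M j) x‖ ≤ 3 * ((ε⁻¹) ^ k * windowDerivConst k) := by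
  classical
  rw [iteratedDeriv_blockFun]
  set s : ℝ := ε⁻¹ * x + M with hs
  -- only the indices with `|s - n| ≤ 1` contribute
  have hvan : ∀ n ∈ blockSet Ω ε M j, ¬ (|s - n| ≤ 1) → iteratedDeriv k (gridBump ε M n) x = 0 := by
    intro n _ hn
    rw [iteratedDeriv_gridBump, iteratedDeriv_pouBump_eq_zero, mul_zero]
    intro hmem
    apply hn
    rw [abs_le]
    have : ε⁻¹ * x + ((M : ℝ) - n) = s - n := by rw [hs]; ring
    rw [this] at hmem
    exact ⟨by linarith [hmem.1], by linarith [hmem.2]⟩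
  rw [← Finset.sum_filter_of_ne fun n hn hne => by
    by_contra hc; exact hne (hvan n hn hc)]
  refine (norm_sum_le _ _).trans ?_
  calc ∑ n ∈ (blockSet Ω ε M j).filter (fun n : ℕ => |s - n| ≤ 1), ‖iteratedDeriv k (gridBump ε M n) x‖
      ≤ ∑ _n ∈ (blockSet Ω ε M j).filter (fun n : ℕ => |s - n| ≤ 1), (ε⁻¹) ^ k * windowDerivConst k :=
        Finset.sum_le_sum fun n _ => norm_iteratedDeriv_gridBump_le hε M n k x
    _ = ((blockSet Ω ε M j).filter (fun n : ℕ => |s - n| ≤ 1)).card * ((ε⁻¹) ^ k * windowDerivConst k) := by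
        rw [Finset.sum_const, nsmul_eq_mul]
    _ ≤ 3 * ((ε⁻¹) ^ k * windowDerivConst k) := by
        gcongr
        · exact mul_nonneg (by positivity) (windowDerivConst_nonneg k)
        · exact_mod_cast card_filter_abs_sub_le_one s _

/-- **The cutoff equals `1` on `Ω`:** for `x ∈ Ω` with `|x| < Mε`, `∑_{n active} p_n(x) = 1`
(every bump that does not vanish at `x` is active). [cite: DyatlovJinNonnenmacher2021, §2.4, proof of Prop. 2.9, Step 1, (2.33) ("supp(1-χ_±) ∩ Ω_± = ∅")] -/
theorem sum_gridBump_activeSet_eq_one {Ω : Set ℝ} {ε : ℝ} (hε : 0 < ε) {M : ℕ} {x : ℝ}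
    (hxΩ : x ∈ Ω) (hx : |x| < M * ε) :
    ∑ n ∈ activeSet Ω ε M, gridBump ε M n x = 1 := by
  classical
  rw [← sum_range_gridBump_eq_one hε hx.le]
  symm
  rw [← Finset.sum_subset (activeSet_subset_range Ω ε M)]
  intro n hn hnot
  -- `n < 2M+1` is not active, so its cell misses `Ω ∋ x`, hence `p_n(x) = 0`
  apply gridBump_eq_zero hε
  intro hxI
  exact hnot (mem_activeSet.2 ⟨Finset.mem_range.1 hn, x, hxΩ, hxI⟩)

/-- The set of block indices. [folklore] -/
def blockIndices (Ω : Set ℝ) (ε : ℝ) (M : ℕ) : Finset ℤ :=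
  (activeSet Ω ε M).image fun n => ⌊gridCenter ε M n⌋

/-- `∑_j χ_j = ∑_{n active} p_n`. [cite: DyatlovJinNonnenmacher2021, §2.4, proof of Prop. 2.9, Step 2 ("χ_± = ∑_j χ_j^±")] -/
theorem sum_blockFun_eq (Ω : Set ℝ) (ε : ℝ) (M : ℕ) (x : ℝ) :
    ∑ j ∈ blockIndices Ω ε M, blockFun Ω ε M j x = ∑ n ∈ activeSet Ω ε M, gridBump ε M n x := by
  classical
  unfold blockFun blockIndices
  have h := Finset.sum_fiberwise_of_maps_to (s := activeSet Ω ε M)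
    (t := (activeSet Ω ε M).image fun n => ⌊gridCenter ε M n⌋) (g := fun n => ⌊gridCenter ε M n⌋)
    (fun n hn => Finset.mem_image_of_mem _ hn) (fun n => gridBump ε M n x)
  rw [← h]
  refine Finset.sum_congr rfl fun j _ => ?_
  refine Finset.sum_congr ?_ fun _ _ => rfl
  ext n
  simp [blockSet, Finset.mem_filter]

/-- **`∑_j χ_j = 1` on `Ω ∩ (-Mε, Mε)`.** [cite: DyatlovJinNonnenmacher2021, §2.4, proof of Prop. 2.9, Steps 1–2] -/
theorem sum_blockFun_eq_one {Ω : Set ℝ} {ε : ℝ} (hε : 0 < ε) {M : ℕ} {x : ℝ} (hxΩ : x ∈ Ω)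
    (hx : |x| < M * ε) : ∑ j ∈ blockIndices Ω ε M, blockFun Ω ε M j x = 1 := by
  rw [sum_blockFun_eq, sum_gridBump_activeSet_eq_one hε hxΩ hx]

/-! ## Products of blocks: Leibniz bounds and Fourier decay (Step 5) -/

/-- `E_N = 9 ∑_{i ≤ N} (N choose i) W_i W_{N-i}`, the constant in `|∂^N(χ_j χ'_{j'})| ≤ E_N ε^{-N}`. [folklore] -/
def blockProdDerivConst (N : ℕ) : ℝ :=
  9 * ∑ i ∈ Finset.range (N + 1), (N.choose i : ℝ) * windowDerivConst i * windowDerivConst (N - i)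

/-- `0 ≤ E_N`. [folklore] -/
theorem blockProdDerivConst_nonneg (N : ℕ) : 0 ≤ blockProdDerivConst N := by
  unfold blockProdDerivConst
  refine mul_nonneg (by norm_num) (Finset.sum_nonneg fun i _ => ?_)
  exact mul_nonneg (mul_nonneg (Nat.cast_nonneg _) (windowDerivConst_nonneg _))
    (windowDerivConst_nonneg _)

/-- **Leibniz:** `|∂^N (χ_j · χ'_{j'})(x)| ≤ E_N ε^{-N}` for two blocks (possibly adapted to
different sets) at the same scale `ε`. [cite: DyatlovJinNonnenmacher2021, §2.4, proof of Prop. 2.9, Step 5 ("χ_k^+ χ_{k'}^+ … satisfies the derivative bounds (2.34)")] -/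
theorem norm_iteratedDeriv_blockFun_mul_le {Ω Ω' : Set ℝ} {ε : ℝ} (hε : 0 < ε)
    (M : ℕ) (j j' : ℤ) (N : ℕ) (x : ℝ) :
    ‖iteratedDeriv N (fun y => blockFun Ω ε M j y * blockFun Ω' ε M j' y) x‖ ≤
      blockProdDerivConst N * (ε⁻¹) ^ N := by
  have hf : ContDiffAt ℝ N (blockFun Ω ε M j) x := (contDiff_blockFun Ω ε M j).contDiffAt
  have hg : ContDiffAt ℝ N (blockFun Ω' ε M j') x := (contDiff_blockFun Ω' ε M j').contDiffAt
  rw [show (fun y => blockFun Ω ε M j y * blockFun Ω' ε M j' y) = blockFun Ω ε M j * blockFun Ω' ε M j'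
    from rfl, iteratedDeriv_mul hf hg]
  refine (norm_sum_le _ _).trans ?_
  unfold blockProdDerivConst
  rw [mul_assoc, Finset.sum_mul, Finset.mul_sum]
  refine Finset.sum_le_sum fun i hi => ?_
  have hiN : i ≤ N := Nat.lt_succ_iff.1 (Finset.mem_range.1 hi)
  rw [norm_mul, norm_mul, Complex.norm_natCast]
  have h1 := norm_iteratedDeriv_blockFun_le (Ω := Ω) hε M j i x
  have h2 := norm_iteratedDeriv_blockFun_le (Ω := Ω') hε M j' (N - i) x
  have hεi : 0 < ε⁻¹ := inv_pos.2 hε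
  have hpow : (ε⁻¹) ^ i * (ε⁻¹) ^ (N - i) = (ε⁻¹) ^ N := by
    rw [← pow_add, Nat.add_sub_cancel' hiN]
  have hW1 := windowDerivConst_nonneg i
  calc (N.choose i : ℝ) * ‖iteratedDeriv i (blockFun Ω ε M j) x‖ *
        ‖iteratedDeriv (N - i) (blockFun Ω' ε M j') x‖
      ≤ (N.choose i : ℝ) * (3 * ((ε⁻¹) ^ i * windowDerivConst i)) *
          (3 * ((ε⁻¹) ^ (N - i) * windowDerivConst (N - i))) :=
        mul_le_mul (mul_le_mul_of_nonneg_left h1 (Nat.cast_nonneg _)) h2 (norm_nonneg _)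
          (mul_nonneg (Nat.cast_nonneg _) (mul_nonneg (by norm_num)
            (mul_nonneg (pow_nonneg hεi.le _) hW1)))
    _ = 9 * ((N.choose i : ℝ) * windowDerivConst i * windowDerivConst (N - i) *
          ((ε⁻¹) ^ i * (ε⁻¹) ^ (N - i))) := by ring
    _ = 9 * ((N.choose i : ℝ) * windowDerivConst i * windowDerivConst (N - i) * (ε⁻¹) ^ N) := by
        rw [hpow]

/-- The product of two blocks and all its derivatives vanish off `[j - ε, j + 1 + ε]`. [folklore] -/
theorem iteratedDeriv_blockFun_mul_eq_zero {Ω Ω' : Set ℝ} {ε : ℝ} (hε : 0 < ε) {M : ℕ} {j j' : ℤ}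
    (N : ℕ) {x : ℝ} (hx : x ∉ Icc ((j : ℝ) - ε) (j + 1 + ε)) :
    iteratedDeriv N (fun y => blockFun Ω ε M j y * blockFun Ω' ε M j' y) x = 0 := by
  have hopen : IsOpen (Icc ((j : ℝ) - ε) (j + 1 + ε))ᶜ := isClosed_Icc.isOpen_compl
  have h : EqOn (fun y => blockFun Ω ε M j y * blockFun Ω' ε M j' y) (fun _ => (0 : ℂ))
      (Icc ((j : ℝ) - ε) (j + 1 + ε))ᶜ := by
    intro y hy
    have : blockFun Ω ε M j y = 0 := by
      by_contra hne; exact hy (mem_of_blockFun_ne_zero hε hne).1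
    simp [this]
  rw [h.iteratedDeriv_of_isOpen hopen N hx, iteratedDeriv_const]
  split_ifs <;> rfl

/-- A product of two blocks is `C^∞`. [folklore] -/
theorem contDiff_blockFun_mul (Ω Ω' : Set ℝ) (ε : ℝ) (M : ℕ) (j j' : ℤ) {k : ℕ∞} :
    ContDiff ℝ k (fun y => blockFun Ω ε M j y * blockFun Ω' ε M j' y) :=
  (contDiff_blockFun Ω ε M j).mul (contDiff_blockFun Ω' ε M j')

/-- All derivatives of a product of two blocks have compact support. [folklore] -/
theorem hasCompactSupport_iteratedDeriv_blockFun_mul {Ω Ω' : Set ℝ} {ε : ℝ} (hε : 0 < ε) (M : ℕ)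
    (j j' : ℤ) (N : ℕ) :
    HasCompactSupport (iteratedDeriv N fun y => blockFun Ω ε M j y * blockFun Ω' ε M j' y) :=
  HasCompactSupport.of_support_subset_isCompact (isCompact_Icc (a := (j : ℝ) - ε) (b := j + 1 + ε))
    fun x hx => by
      by_contra h
      exact (Function.mem_support.1 hx) (iteratedDeriv_blockFun_mul_eq_zero hε N h)

/-- All derivatives of a product of two blocks are integrable. [folklore] -/
theorem integrable_iteratedDeriv_blockFun_mul {Ω Ω' : Set ℝ} {ε : ℝ} (hε : 0 < ε) (M : ℕ)
    (j j' : ℤ) (N : ℕ) :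
    Integrable (iteratedDeriv N fun y => blockFun Ω ε M j y * blockFun Ω' ε M j' y) :=
  ((contDiff_blockFun_mul Ω Ω' ε M j j').continuous_iteratedDeriv N (by exact_mod_cast le_top)
    ).integrable_of_hasCompactSupport (hasCompactSupport_iteratedDeriv_blockFun_mul hε M j j' N)

/-- `∫ |∂^N(χ_j χ'_{j'})| ≤ 2 E_N ε^{-N}` (`ε ≤ 1/2`: the support has length `1 + 2ε ≤ 2`). [folklore] -/
theorem integral_norm_iteratedDeriv_blockFun_mul_le {Ω Ω' : Set ℝ} {ε : ℝ} (hε : 0 < ε)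
    (hε2 : ε ≤ 1 / 2) (M : ℕ) (j j' : ℤ) (N : ℕ) :
    ∫ x, ‖iteratedDeriv N (fun y => blockFun Ω ε M j y * blockFun Ω' ε M j' y) x‖ ≤
      2 * (blockProdDerivConst N * (ε⁻¹) ^ N) := by
  set g := iteratedDeriv N (fun y => blockFun Ω ε M j y * blockFun Ω' ε M j' y) with hg
  have hzero : ∀ x, x ∉ Icc ((j : ℝ) - ε) (j + 1 + ε) → ‖g x‖ = 0 := fun x hx => by
    rw [hg, iteratedDeriv_blockFun_mul_eq_zero hε N hx, norm_zero]
  rw [← setIntegral_eq_integral_of_forall_compl_eq_zero (s := Icc ((j : ℝ) - ε) (j + 1 + ε))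
    (fun x hx => hzero x hx)]
  have hvol : volume.real (Icc ((j : ℝ) - ε) (j + 1 + ε)) = 1 + 2 * ε := by
    rw [Real.volume_real_Icc_of_le (by linarith)]; ring
  calc ∫ x in Icc ((j : ℝ) - ε) (j + 1 + ε), ‖g x‖
      ≤ ∫ _x in Icc ((j : ℝ) - ε) (j + 1 + ε), blockProdDerivConst N * (ε⁻¹) ^ N := by
        refine setIntegral_mono_on (integrable_iteratedDeriv_blockFun_mul hε M j j' N).norm.integrableOn
          (integrableOn_const (by rw [Real.volume_Icc]; exact ENNReal.ofReal_ne_top))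
          measurableSet_Icc fun x _ => ?_
        exact norm_iteratedDeriv_blockFun_mul_le hε M j j' N x
    _ = (1 + 2 * ε) * (blockProdDerivConst N * (ε⁻¹) ^ N) := by
        rw [setIntegral_const, smul_eq_mul, hvol]
    _ ≤ 2 * (blockProdDerivConst N * (ε⁻¹) ^ N) := by
        gcongr
        · exact mul_nonneg (blockProdDerivConst_nonneg N) (by positivity)
        · linarith

/-- **Non-stationary phase for a product of blocks (Step 5):**
`(2π|w|)^N |𝓕(χ_j χ'_{j'})(w)| ≤ 2 E_N ε^{-N}` for all `w`, `N`. [cite: DyatlovJinNonnenmacher2021, §2.4, proof of Prop. 2.9, Step 5 ("Integrating by parts N times in ξ, we get sup|𝒦| ≤ C_N h^{-1}|j-j'|^{-N}")] -/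
theorem pow_mul_norm_fourier_blockFun_mul_le {Ω Ω' : Set ℝ} {ε : ℝ} (hε : 0 < ε) (hε2 : ε ≤ 1 / 2)
    (M : ℕ) (j j' : ℤ) (N : ℕ) (w : ℝ) :
    (2 * π * |w|) ^ N * ‖𝓕 (fun y => blockFun Ω ε M j y * blockFun Ω' ε M j' y) w‖ ≤
      2 * (blockProdDerivConst N * (ε⁻¹) ^ N) :=
  (pow_mul_norm_fourier_le (contDiff_blockFun_mul Ω Ω' ε M j j')
    (integrable_iteratedDeriv_blockFun_mul hε M j j') N w).trans
    (integral_norm_iteratedDeriv_blockFun_mul_le hε hε2 M j j' N)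

end Literature.Analysis.Fourier
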